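import Literature.IUT.HodgeArakelov.CohomologySystemOfContH1
import Literature.AnabelianGeometry.EtaleTheta.ContH1ConjAction
import Mathlib.Topology.Algebra.Group.ClosedSubgroup
import Mathlib.Topology.Algebra.OpenSubgroup
import Mathlib.GroupTheory.Index

/-!
# The conjugation (inversion) action on the cohomology limit `lim_J H¹(Π_Ÿ(Π)|_J, (l·Δ_Θ)(Π))`

Companion (abc-iut cell, D-0067 wave 4, seat abc-iut-w4-d043; DISCHARGE-L6 row F14-b, MODEL step) to
abc-iut-L6-t1's `CohomologySystemOfContH1.lean` (p411226: the [IUTchII] Prop. 1.4 interface `CohomologySystem`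
instantiated from L2's continuous `H¹`). S. Mochizuki, *Inter-universal Teichmüller theory II*, kurims
manuscript (Dec. 2020): Cor. 1.12 (i) pp. 56–57 — "`ι` is a `Δ_Ÿ(Π)`-outer automorphism of `Π_Ÿ(Π)`"
(p. 56) and "`ι` induces an “action up to torsion” on some subset “`(−)`” of an abelian group" (p. 57); Prop. 2.2
(ii) p. 66 (the `ι`-invariant classes; no quotation intended). The landed `ConstantMultipleRigidity.lean` (p410537) carries this action as the
INTERFACE DATUM `ThetaEvaluation.iotaLim : lim ≃+ lim` ("NOT derivable here since `CohomologySystem` carries no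
functoriality in automorphisms of `Π`"), and plan/GAP-LEDGER row G-w4d010-2 (a) asks for exactly the datum
`ρ : H1 ⊤ ≃+ H1 ⊤`, `ρlim : lim ≃+ lim` with `toLim ⊤ ∘ ρ = ρlim ∘ toLim ⊤` over `D.coh`.

HERE that functoriality is CONSTRUCTED for the instantiated system `cohomologySystemOfContH1 φ A H` with `H`
NORMAL in `Π` (the model: `Π_Ÿ ⊴ Π^tp_X̲̲`, abc-iut-L6-t1 `EtaleThetaDataOfSetting.piYdd_normal`) and any
`σ : Π` (the inversion `ι_Ÿ` of Rmk. 1.4.1 (ii) is induced by an element of `Π = Π^tp_{X̲̲}` normalising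
`Π_Ÿ`): the conjugation maps `H¹(H ⊓ K, A) → H¹(H ⊓ K, A)` of L2's `ContH1.conj` exist only at NORMAL `K`, so
each member `H¹(H ⊓ K, A)` (`K` finite-index open) is first restricted to the NORMAL CORE of `K` — again
finite-index open (`Idx.core`) — then conjugated, then sent to the limit; these maps are compatible with the
transition maps (`conjAt_fmod`), giving
* `h1LimConj σ : lim →+ lim` (`DirectLimit.lift`), computed on generators at normal levels by `ContH1.conj`
  (`h1LimConj_of_normal`), with `h1LimConj_one`, `h1LimConj_mul` (an ACTION of `Π`), hence the additive
  AUTOMORPHISM `h1LimConjEquiv σ : lim ≃+ lim` (inverse `σ⁻¹`);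
* at the top level `H1 ⊤ ≅ H¹(H ⊓ ⊤, A)` (`h1EquivOfFiniteIndexOpen`), the automorphism `h1TopConjEquiv σ` and
  the printed compatibility `toLim ⊤ ∘ ρ = ρlim ∘ toLim ⊤` (`toLim_h1TopConjEquiv`) — the shape (a) of
  G-w4d010-2 and of `ThetaEvaluation.iotaLim`/`iotaQuot`; read through `H1 ⊤ ≅ H¹(H ⊓ ⊤, A)` the top-level
  action is `e.symm y ↦ e.symm (conj σ y)` (`h1TopConjEquiv_symm_apply`, `range_h1TopConjEquiv_symm` — the
  form of abc-iut-L6-t1's `orbitOne = {e.symm (conj σ η) | σ}`), and `H` itself acts trivially there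
  (`h1TopConjEquiv_eq_self_of_mem`: the action factors through `Π/H`, at the model `(l·ℤ) × μ₂`), with the
  action laws `h1TopConjEquiv_mul_apply` / `h1TopConjEquiv_one_apply` (so translates `ρ_{γ̃^n} η̈` of a class
  make sense as an orbit of a group action).
Elements of `H ⊓ K` act trivially on `H¹(H ⊓ K, A)` (L2 `conj_eq_self_of_mem`), so on classes coming from
level `K` the action of `σ` depends only on `σ` modulo `H ⊓ core K` — the "outer" nature of `ι` at each
finite level (`h1LimConj_of_normal_eq_of_mem`). A construction over Mathlib + the landed files; nothing of
[IUTchII] is asserted (claim key of the interface `Mochizuki2012`, D-0012 disputed; no side taken on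
[IUTchIII] Cor. 3.12).
-/

namespace Literature.IUT.HodgeArakelov

open Literature.AnabelianGeometry.EtaleTheta CohomologySystemOfContH1

universe u

noncomputable section

variable {P : TopGroup.{u}} {G' : Type u} [Group G'] [TopologicalSpace G'] [IsTopologicalGroup G']
  (φ : P →* G') (A : Subgroup G') [A.Normal] [IsMulCommutative A] (H : Subgroup P)

namespace CohomologySystemOfContH1

/-! ### Restriction commutes with conjugation -/

/-- For nested NORMAL subgroups `H₁ ≤ H₂` of `Π`, restriction `H¹(H₂, A) → H¹(H₁, A)` commutes with the
conjugation action of `σ ∈ Π` (both are "precompose the cocycle", definitionally).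
[cite: NeukirchSchmidtWingberg2008, I §5] -/
theorem res_conj {H₁ H₂ : Subgroup P} [H₁.Normal] [H₂.Normal] (h : H₁ ≤ H₂) (σ : P) (x : ContH1 φ A H₂) :
    ContH1.res φ A h (ContH1.conj φ A σ x) = ContH1.conj φ A σ (ContH1.res φ A h x) := by
  induction x using QuotientGroup.induction_on with
  | H f => rfl

/-! ### Normal cores of the indices -/

variable {H}

/-- The NORMAL CORE of a finite-index open subgroup `K` of the topological group `Π` is again finite-index
(Mathlib `Subgroup.finiteIndex_normalCore`) and open (it is closed — an intersection of conjugates of the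
closed subgroup `K` — and of finite index); as an index of the system over `⊥`.
[cite: Mochizuki2012, Prop 1.4 p.27] -/
def Idx.core (i : Idx (P := P) ⊥) : Idx (P := P) ⊥ :=
  OrderDual.toDual
    ⟨(i.K).normalCore,
      (haveI := (OrderDual.ofDual i).2.1; inferInstance),
      (by
        haveI := (OrderDual.ofDual i).2.1
        exact Subgroup.isOpen_of_isClosed_of_finiteIndex _
          ((i.K).normalCore_isClosed ((i.K).isClosed_of_isOpen (OrderDual.ofDual i).2.2.1))),
      bot_le⟩

/-- The subgroup of the core index is the normal core. [cite: Mochizuki2012, Prop 1.4 p.27] -/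
@[simp] theorem Idx.core_K (i : Idx (P := P) ⊥) : i.core.K = (i.K).normalCore := rfl

/-- The normal core is a normal subgroup (instance for the core index). [cite: Mochizuki2012, Prop 1.4 p.27] -/
instance Idx.core_normal (i : Idx (P := P) ⊥) : (i.core.K).Normal :=
  inferInstanceAs ((i.K).normalCore.Normal)

/-- `H ⊓ (core K)` is normal for `H` normal. [cite: Mochizuki2012, Prop 1.4 p.27] -/
instance Idx.inf_core_normal [H.Normal] (i : Idx (P := P) ⊥) : (H ⊓ i.core.K).Normal :=
  Subgroup.normal_inf_normal H _

/-- `core K ≤ K`, i.e. `i ≤ i.core` in the (reverse-inclusion) index order. [cite: Mochizuki2012, Prop 1.4 p.27] -/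
theorem Idx.le_core (i : Idx (P := P) ⊥) : i ≤ i.core :=
  Idx.le_iff.mpr (i.K).normalCore_le

/-- Monotonicity of the core: `K_j ≤ K_i ⇒ core K_j ≤ core K_i`. [cite: Mochizuki2012, Prop 1.4 p.27] -/
theorem Idx.core_mono {i j : Idx (P := P) ⊥} (hij : i ≤ j) : i.core ≤ j.core :=
  Idx.le_iff.mpr (Subgroup.normalCore_mono (Idx.le_iff.mp hij))

variable (H) [H.Normal]

/-! ### The conjugation maps on the members and their compatibility -/

/-- Conjugation by `σ` on the member at `K`, valued in the limit: restrict `H¹(H ⊓ K, A)` to the normal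
level `H ⊓ core K`, conjugate there (`ContH1.conj`), and map to the limit.
[cite: Mochizuki2012, Cor 1.12 (i) p.56] -/
def conjAt (σ : P) (i : Idx (P := P) ⊥) : Gmod φ A H ⊥ i →+ h1Lim φ A H ⊥ :=
  (h1Of φ A H ⊥ i.core).comp
    ((MonoidHom.toAdditive (ContH1.conj φ A (H := H ⊓ i.core.K) σ)).comp (fmod φ A H ⊥ i i.core i.le_core))

/-- `conjAt` unfolded. [cite: Mochizuki2012, Cor 1.12 (i) p.56] -/
theorem conjAt_apply (σ : P) (i : Idx (P := P) ⊥) (x : Gmod φ A H ⊥ i) :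
    conjAt φ A H σ i x =
      h1Of φ A H ⊥ i.core
        (MonoidHom.toAdditive (ContH1.conj φ A (H := H ⊓ i.core.K) σ) (fmod φ A H ⊥ i i.core i.le_core x)) :=
  rfl

/-- At a level `K` with `H ⊓ K` already normal, conjugation needs no passage to the core: in the limit,
`conjAt σ` is `ContH1.conj σ` at level `K`. [cite: Mochizuki2012, Cor 1.12 (i) p.56] -/
theorem conjAt_eq_of_normal (σ : P) (i : Idx (P := P) ⊥) [(H ⊓ i.K).Normal] (x : Gmod φ A H ⊥ i) :
    conjAt φ A H σ i x = h1Of φ A H ⊥ i (MonoidHom.toAdditive (ContH1.conj φ A (H := H ⊓ i.K) σ) x) := by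
  rw [conjAt_apply]
  have h : MonoidHom.toAdditive (ContH1.conj φ A (H := H ⊓ i.core.K) σ) (fmod φ A H ⊥ i i.core i.le_core x) =
      fmod φ A H ⊥ i i.core i.le_core (MonoidHom.toAdditive (ContH1.conj φ A (H := H ⊓ i.K) σ) x) :=
    (congrArg Additive.ofMul (res_conj φ A _ σ (Additive.toMul x))).symm
  rw [h, h1Of_fmod]

/-- Compatibility of the conjugation maps with the transition maps of the system (`K_j ≤ K_i`).
[cite: Mochizuki2012, Cor 1.12 (i) p.56] -/
theorem conjAt_fmod (σ : P) {i j : Idx (P := P) ⊥} (hij : i ≤ j) (x : Gmod φ A H ⊥ i) :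
    conjAt φ A H σ j (fmod φ A H ⊥ i j hij x) = conjAt φ A H σ i x := by
  rw [conjAt_apply, conjAt_apply]
  -- move the right-hand side from `core K_i` down to `core K_j`
  rw [← h1Of_fmod φ A H ⊥ (Idx.core_mono hij)]
  congr 1
  -- both sides are `conj σ` of the restriction of `x` to `H ⊓ core K_j`
  have lhs : fmod φ A H ⊥ j j.core j.le_core (fmod φ A H ⊥ i j hij x) =
      fmod φ A H ⊥ i j.core (hij.trans j.le_core) x :=
    congrArg Additive.ofMul (ContH1.res_res _ _ (Additive.toMul x))
  have rhs : fmod φ A H ⊥ i.core j.core (Idx.core_mono hij)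
        (MonoidHom.toAdditive (ContH1.conj φ A (H := H ⊓ i.core.K) σ) (fmod φ A H ⊥ i i.core i.le_core x)) =
      MonoidHom.toAdditive (ContH1.conj φ A (H := H ⊓ j.core.K) σ)
        (fmod φ A H ⊥ i.core j.core (Idx.core_mono hij) (fmod φ A H ⊥ i i.core i.le_core x)) :=
    congrArg Additive.ofMul (res_conj φ A _ σ _)
  have rhs' : fmod φ A H ⊥ i.core j.core (Idx.core_mono hij) (fmod φ A H ⊥ i i.core i.le_core x) =
      fmod φ A H ⊥ i j.core (hij.trans j.le_core) x :=
    congrArg Additive.ofMul (ContH1.res_res _ _ (Additive.toMul x))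
  rw [lhs, rhs, rhs']

/-! ### The action on the limit -/

/-- **Conjugation by `σ ∈ Π` on `lim_K H¹(H|_K, A)`** (DEFINED by the universal property of the direct
limit from the compatible family `conjAt σ`). [cite: Mochizuki2012, Cor 1.12 (i) p.56] -/
def h1LimConj (σ : P) : h1Lim φ A H ⊥ →+ h1Lim φ A H ⊥ :=
  AddCommGroup.DirectLimit.lift (Gmod φ A H ⊥) (fmod φ A H ⊥) (h1Lim φ A H ⊥)
    (fun i => conjAt φ A H σ i)
    (fun _ _ hij x => conjAt_fmod φ A H σ hij x)

/-- `h1LimConj` on generators. [cite: Mochizuki2012, Cor 1.12 (i) p.56] -/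
@[simp] theorem h1LimConj_of (σ : P) (i : Idx (P := P) ⊥) (x : Gmod φ A H ⊥ i) :
    h1LimConj φ A H σ (h1Of φ A H ⊥ i x) = conjAt φ A H σ i x :=
  AddCommGroup.DirectLimit.lift_of (G := Gmod φ A H ⊥) (f := fmod φ A H ⊥) _ _ _ i x

/-- `h1LimConj` on generators of a NORMAL level is `ContH1.conj` there.
[cite: Mochizuki2012, Cor 1.12 (i) p.56] -/
theorem h1LimConj_of_normal (σ : P) (i : Idx (P := P) ⊥) [(H ⊓ i.K).Normal] (x : Gmod φ A H ⊥ i) :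
    h1LimConj φ A H σ (h1Of φ A H ⊥ i x) =
      h1Of φ A H ⊥ i (MonoidHom.toAdditive (ContH1.conj φ A (H := H ⊓ i.K) σ) x) := by
  rw [h1LimConj_of, conjAt_eq_of_normal]

/-- Elements of the level subgroup act trivially on the classes of that level: for `σ ∈ H ⊓ K` (`H ⊓ K`
normal), `h1LimConj σ` fixes the image of `H¹(H ⊓ K, A)` — at each finite level the action factors through
the finite quotient, i.e. `ι` acts as an OUTER automorphism. [cite: Mochizuki2012, Cor 1.12 (i) p.56] -/
theorem h1LimConj_of_normal_eq_of_mem (σ : P) (i : Idx (P := P) ⊥) [(H ⊓ i.K).Normal]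
    (hσ : σ ∈ H ⊓ i.K) (x : Gmod φ A H ⊥ i) :
    h1LimConj φ A H σ (h1Of φ A H ⊥ i x) = h1Of φ A H ⊥ i x := by
  rw [h1LimConj_of_normal]
  exact congrArg (h1Of φ A H ⊥ i) (congrArg Additive.ofMul (ContH1.conj_eq_self_of_mem σ hσ (Additive.toMul x)))

/-- `1 ∈ Π` acts as the identity. [cite: Mochizuki2012, Cor 1.12 (i) p.56] -/
theorem h1LimConj_one : h1LimConj φ A H (1 : P) = AddMonoidHom.id _ := by
  refine h1Lim_hom_ext φ A H fun i x => ?_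
  rw [h1LimConj_of, conjAt_apply, AddMonoidHom.id_apply]
  have h : MonoidHom.toAdditive (ContH1.conj φ A (H := H ⊓ i.core.K) (1 : P)) (fmod φ A H ⊥ i i.core i.le_core x) =
      fmod φ A H ⊥ i i.core i.le_core x :=
    congrArg Additive.ofMul (ContH1.conj_one_apply (Additive.toMul (fmod φ A H ⊥ i i.core i.le_core x)))
  rw [h, h1Of_fmod]

/-- **Action law**: `conj (σ τ) = conj σ ∘ conj τ` on the limit. [cite: Mochizuki2012, Cor 1.12 (i) p.56] -/
theorem h1LimConj_mul (σ τ : P) :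
    h1LimConj φ A H (σ * τ) = (h1LimConj φ A H σ).comp (h1LimConj φ A H τ) := by
  refine h1Lim_hom_ext φ A H fun i x => ?_
  rw [AddMonoidHom.comp_apply, h1LimConj_of, h1LimConj_of, conjAt_apply, conjAt_apply,
    h1LimConj_of_normal]
  congr 1
  exact congrArg Additive.ofMul (ContH1.conj_mul_apply σ τ (Additive.toMul (fmod φ A H ⊥ i i.core i.le_core x)))

/-- Pointwise action law. [cite: Mochizuki2012, Cor 1.12 (i) p.56] -/
theorem h1LimConj_mul_apply (σ τ : P) (x : h1Lim φ A H ⊥) :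
    h1LimConj φ A H (σ * τ) x = h1LimConj φ A H σ (h1LimConj φ A H τ x) := by
  rw [h1LimConj_mul]; rfl

/-- Pointwise identity law. [cite: Mochizuki2012, Cor 1.12 (i) p.56] -/
theorem h1LimConj_one_apply (x : h1Lim φ A H ⊥) : h1LimConj φ A H (1 : P) x = x := by
  rw [h1LimConj_one]; rfl

/-- **The automorphism of `lim_K H¹(H|_K, A)` induced by `σ ∈ Π`** (inverse: `σ⁻¹`) — the shape of the
interface datum `ThetaEvaluation.iotaLim` / of `ρlim` in GAP row G-w4d010-2 (a), CONSTRUCTED.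
[cite: Mochizuki2012, Cor 1.12 (i) p.56] -/
def h1LimConjEquiv (σ : P) : h1Lim φ A H ⊥ ≃+ h1Lim φ A H ⊥ where
  toFun := h1LimConj φ A H σ
  invFun := h1LimConj φ A H σ⁻¹
  left_inv x := by
    rw [← h1LimConj_mul_apply, inv_mul_cancel, h1LimConj_one_apply]
  right_inv x := by
    rw [← h1LimConj_mul_apply, mul_inv_cancel, h1LimConj_one_apply]
  map_add' := map_add _

/-- `h1LimConjEquiv σ` is `h1LimConj σ` as a function. [cite: Mochizuki2012, Cor 1.12 (i) p.56] -/
@[simp] theorem h1LimConjEquiv_apply (σ : P) (x : h1Lim φ A H ⊥) :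
    h1LimConjEquiv φ A H σ x = h1LimConj φ A H σ x := rfl

/-! ### The top level `H1 ⊤ ≅ H¹(H, A)` and the compatibility `toLim ⊤ ∘ ρ = ρlim ∘ toLim ⊤` -/

/-- Conjugation by `σ` on `H¹(H ⊓ ⊤, A)` as an additive automorphism (L2's `ContH1.conj`, bijective with
inverse `conj σ⁻¹`). [cite: Mochizuki2012, Cor 1.12 (i) p.56] -/
def conjTopEquiv (σ : P) : Additive (ContH1 φ A (H ⊓ (⊤ : Subgroup P))) ≃+ Additive (ContH1 φ A (H ⊓ ⊤)) :=
  (MulEquiv.ofBijective (ContH1.conj φ A (H := H ⊓ ⊤) σ) (ContH1.conj_bijective σ)).toAdditive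

/-- `conjTopEquiv σ` is `ContH1.conj σ` as a function. [cite: Mochizuki2012, Cor 1.12 (i) p.56] -/
@[simp] theorem conjTopEquiv_apply (σ : P) (x : Additive (ContH1 φ A (H ⊓ (⊤ : Subgroup P)))) :
    conjTopEquiv φ A H σ x = MonoidHom.toAdditive (ContH1.conj φ A (H := H ⊓ ⊤) σ) x := rfl

/-- **The automorphism `ρ` of `H1 ⊤`** induced by `σ` (through `H1 ⊤ ≅ H¹(H ⊓ ⊤, A)`) — the shape of `ρ` in
GAP row G-w4d010-2 (a), CONSTRUCTED. [cite: Mochizuki2012, Cor 1.12 (i) p.56] -/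
def h1TopConjEquiv (σ : P) :
    (cohomologySystemOfContH1 φ A H).H1 ⊤ ≃+ (cohomologySystemOfContH1 φ A H).H1 ⊤ :=
  ((h1EquivOfFiniteIndexOpen φ A H ⊤ inferInstance (by simp)).trans (conjTopEquiv φ A H σ)).trans
    (h1EquivOfFiniteIndexOpen φ A H ⊤ inferInstance (by simp)).symm

/-- `h1TopConjEquiv σ` read through `H1 ⊤ ≅ H¹(H ⊓ ⊤, A)`: on `e.symm y` it is `e.symm (conj σ y)` — the
form in which orbits of classes are written at the model (abc-iut-L6-t1 `EtaleThetaDataOfSetting.orbitOne`: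
`{e.symm (conj σ η) | σ}`). [cite: Mochizuki2012, Prop 1.4 p.27] -/
theorem h1TopConjEquiv_symm_apply (σ : P) (y : Additive (ContH1 φ A (H ⊓ (⊤ : Subgroup P)))) :
    h1TopConjEquiv φ A H σ ((h1EquivOfFiniteIndexOpen φ A H ⊤ inferInstance (by simp)).symm y) =
      (h1EquivOfFiniteIndexOpen φ A H ⊤ inferInstance (by simp)).symm
        (MonoidHom.toAdditive (ContH1.conj φ A (H := H ⊓ ⊤) σ) y) := by
  change (h1EquivOfFiniteIndexOpen φ A H ⊤ inferInstance (by simp)).symm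
      (conjTopEquiv φ A H σ (h1EquivOfFiniteIndexOpen φ A H ⊤ inferInstance (by simp)
        ((h1EquivOfFiniteIndexOpen φ A H ⊤ inferInstance (by simp)).symm y))) = _
  rw [AddEquiv.apply_symm_apply, conjTopEquiv_apply]

/-- The orbit of a top-level class under the action IS its `Π`-conjugacy orbit read through
`H1 ⊤ ≅ H¹(H ⊓ ⊤, A)` (so e.g. `orbitOne = {h1TopConjEquiv σ x₀ | σ}` at the model).
[cite: Mochizuki2012, Prop 1.4 p.27] -/
theorem range_h1TopConjEquiv_symm (y : Additive (ContH1 φ A (H ⊓ (⊤ : Subgroup P)))) :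
    Set.range (fun σ : P => h1TopConjEquiv φ A H σ
        ((h1EquivOfFiniteIndexOpen φ A H ⊤ inferInstance (by simp)).symm y)) =
      {z | ∃ σ : P, z = (h1EquivOfFiniteIndexOpen φ A H ⊤ inferInstance (by simp)).symm
        (MonoidHom.toAdditive (ContH1.conj φ A (H := H ⊓ ⊤) σ) y)} := by
  ext z
  simp only [Set.mem_range, h1TopConjEquiv_symm_apply]
  constructor
  · rintro ⟨σ, rfl⟩; exact ⟨σ, rfl⟩
  · rintro ⟨σ, rfl⟩; exact ⟨σ, rfl⟩

/-- **`H` acts trivially at the top level**: for `σ ∈ H`, `h1TopConjEquiv σ = id` (L2 `conj_eq_self_of_mem`),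
so the action of `Π` on `H1 ⊤ ≅ H¹(H, A)` factors through `Π/H` (at the model: through
`Π^tp_X̲̲/Π^tp_Ÿ̲̲ ≅ (l·ℤ) × μ₂`, the group generating the orbit `η̈^{Θ,l·ℤ×μ₂}`).
[cite: Mochizuki2012, Prop 1.4 p.27] -/
theorem h1TopConjEquiv_eq_self_of_mem {σ : P} (hσ : σ ∈ H) (x : (cohomologySystemOfContH1 φ A H).H1 ⊤) :
    h1TopConjEquiv φ A H σ x = x := by
  have hx : x = (h1EquivOfFiniteIndexOpen φ A H ⊤ inferInstance (by simp)).symm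
      (h1EquivOfFiniteIndexOpen φ A H ⊤ inferInstance (by simp) x) :=
    ((h1EquivOfFiniteIndexOpen φ A H ⊤ inferInstance (by simp)).symm_apply_apply x).symm
  rw [hx, h1TopConjEquiv_symm_apply]
  congr 1
  exact congrArg Additive.ofMul
    (ContH1.conj_eq_self_of_mem σ (show σ ∈ H ⊓ (⊤ : Subgroup P) from ⟨hσ, trivial⟩) _)

/-- Top-level action law: `ρ_{στ} = ρ_σ ∘ ρ_τ`. [cite: Mochizuki2012, Prop 1.4 p.27] -/
theorem h1TopConjEquiv_mul_apply (σ τ : P) (x : (cohomologySystemOfContH1 φ A H).H1 ⊤) :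
    h1TopConjEquiv φ A H (σ * τ) x = h1TopConjEquiv φ A H σ (h1TopConjEquiv φ A H τ x) := by
  have hx : x = (h1EquivOfFiniteIndexOpen φ A H ⊤ inferInstance (by simp)).symm
      (h1EquivOfFiniteIndexOpen φ A H ⊤ inferInstance (by simp) x) :=
    ((h1EquivOfFiniteIndexOpen φ A H ⊤ inferInstance (by simp)).symm_apply_apply x).symm
  rw [hx, h1TopConjEquiv_symm_apply, h1TopConjEquiv_symm_apply, h1TopConjEquiv_symm_apply]
  congr 1
  exact congrArg Additive.ofMul (ContH1.conj_mul_apply σ τ _)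

/-- Top-level identity law: `ρ_1 = id`. [cite: Mochizuki2012, Prop 1.4 p.27] -/
theorem h1TopConjEquiv_one_apply (x : (cohomologySystemOfContH1 φ A H).H1 ⊤) :
    h1TopConjEquiv φ A H (1 : P) x = x :=
  h1TopConjEquiv_eq_self_of_mem φ A H (σ := 1) H.one_mem x

/-- **Compatibility `toLim ⊤ ∘ ρ = ρlim ∘ toLim ⊤`** of the top-level and limit-level conjugation
automorphisms (the equation of GAP row G-w4d010-2 (a); the sense in which `ThetaEvaluation.iotaLim` is
"induced by `I.iotaYdd`"). [cite: Mochizuki2012, Cor 1.12 (i) p.56] -/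
theorem toLim_h1TopConjEquiv (σ : P) (x : (cohomologySystemOfContH1 φ A H).H1 ⊤) :
    (cohomologySystemOfContH1 φ A H).toLim ⊤ (h1TopConjEquiv φ A H σ x) =
      h1LimConjEquiv φ A H σ ((cohomologySystemOfContH1 φ A H).toLim ⊤ x) := by
  have hx : x = (h1EquivOfFiniteIndexOpen φ A H ⊤ inferInstance (by simp)).symm
      (h1EquivOfFiniteIndexOpen φ A H ⊤ inferInstance (by simp) x) :=
    ((h1EquivOfFiniteIndexOpen φ A H ⊤ inferInstance (by simp)).symm_apply_apply x).symm
  have h1 : h1TopConjEquiv φ A H σ x = (h1EquivOfFiniteIndexOpen φ A H ⊤ inferInstance (by simp)).symm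
      (conjTopEquiv φ A H σ (h1EquivOfFiniteIndexOpen φ A H ⊤ inferInstance (by simp) x)) := rfl
  rw [h1]
  conv_rhs => rw [hx]
  rw [h1LimConjEquiv_apply, toLim_h1Equiv_symm, toLim_h1Equiv_symm, conjTopEquiv_apply]
  haveI : (H ⊓ ((Idx.self (P := P) ⊤ inferInstance (by simp)).incl (bot_le : (⊥ : Subgroup P) ≤ ⊤)).K).Normal :=
    inferInstanceAs ((H ⊓ (⊤ : Subgroup P)).Normal)
  rw [h1LimConj_of_normal]
  rfl

end CohomologySystemOfContH1

end

end Literature.IUT.HodgeArakelov
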